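import Summits.Ventures.HSemireg.WedgeWeilCarrier
import Summits.Ventures.HSemireg.WedgeWeilPurityLocus

/-!
# Venture HSemireg — the Weil-frame PURITY LOCUS ON THE p4 CARRIER: `dim S_n(f(Θ) + a·w₊ + b·w₋) + 4 + 2·[(−1)ⁿab = c₁c₂(λ−μ)^{2n}] = 4·C(2n,n)`,
# and at `n = 2` for the TREE's `ContractionSpan.span ↑L ↑(Ann L) x` literally: `18` on the locus, `20` off it

HONEST FRAMING. Part of the Lean index of the computation cell `pub-hsemireg` (seat p6 gen 6; th-7's NOT-COVERED item
(ii) of theory/th7/WeilPurity.lean v2 / LEAN-ASSETS-README File 14: «the CARRIER side — compose with the carrier bridge as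
THEOREM R does»).  Finite-dimensional exterior algebra over a field ONLY: no variety, no cohomology theory, no semiregularity
map is constructed here; nothing here says that HC / HC_CM / HC_AV holds; no Literature fact is declared or used.

WHAT IS PROVED.  In the setting of `WedgeWeilCarrier.lean` (seat p4): a `K`-space `V` with an ADAPTED BASIS
`bV : Fin ((n+n) + (n+n)) → V` (`ℓ_a := bV a`, `m_a := bV ((n+n) + a)`, `L := span ℓ`), the h-part `f := Ecl bV q (n+n)`
(`= Σ_m q_m Θ^m/m!`, `Θ = Σ_a ℓ_a ∧ m_a`) with a TWO-EXPONENTIAL coefficient sequence `q_k = c₁λ^k + c₂μ^k` (`λ ≠ μ`), and the two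
carrier Weil vectors `w₊ := wUp bV n`, `w₋ := wLow bV n` (top forms of the two adapted blocks).  Then for `c₁c₂ab ≠ 0`, every
field, every `n ≥ 1` (`finrank_S_weil_purity`):
`dim S_n(f + a·w₊ + b·w₋) + 4 + 2·[(−1)ⁿ·ab = c₁c₂(λ−μ)^{2n}] = 4·C(2n,n)`
— th-7's PURITY-LOCUS LAW (`Wedge.WeilPurity.weilPurity`, FORMULA-N PART B §L.5, STRUCTURE.md C16) read on the bridge's
degree-`n` contraction span `S_n` of `WedgeCarrierBridge.lean`; and at `n = 2`, where `S_2` IS the tree's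
`ContractionSpan.span ↑L ↑(Ann L) x` (`WedgeBridge.S_two_eq`), `finrank_contractionSpan_weil_purity_two`:
`dim ContractionSpan.span ↑(Lsp bV) ↑(Ann) (f + a·w₊ + b·w₋) = 18` if `ab = c₁c₂(λ−μ)⁴`, `= 20` otherwise — the census
anchor T4a `r(𝓔) = 18` (g = 4) in the Weil frame, with its off-locus companion `20`.
PROOF = TRANSPORT ONLY, with EXACT constants: under the adapted isomorphism `Ψ : ⋀W ≃ ⋀(K^{Fin(2N)})` of `WedgeC15.lean`
(`Ψ(x_c) = Y_c`, `Ψ(y_c) = X_c`) the bridge-side block products `x_n⋯x_{2n−1}·y_n⋯y_{2n−1}` and `x_0⋯x_{n−1}·y_0⋯y_{n−1}` of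
`WedgeWeilCarrier.lean` go to `(−1)^{C(n+1,2)}` times th-7's PAIR PRODUCTS `Π(x_c ∧ y_c)` (`Ψ_up_pp`, `Ψ_low_pp`: the letters
arrive as `Y_n⋯Y_{2n−1}·X_n⋯X_{2n−1}`, un-interleaved by `Yp_mul_Xp`); with p4's EXACT carrier dictionary `Φ_up` (no sign) /
`Φ_low` (sign `(−1)^{n·n}`) the class `f + a·w₊ + b·w₋` is `Φ_ω` of a bridge element whose `Ψ`-image is th-7's
`vP c₁ c₂ λ μ (a·s) (b·(−1)^{n·n}·s)`, `s = (−1)^{C(n+1,2)}` (`finrank_S_weil_eq_vP`); the product of the two transported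
coefficients is `(−1)^{n·n}·ab = (−1)ⁿ·ab`, whence the locus as stated.  No structure constant of the monomial basis is
evaluated (p4's `Ψ_up`/`Ψ_low` name units; here the units are computed from the letters directly).
The geometric DICTIONARY (Weil-type abelian `2n`-fold: `V = H¹`, `L = H^{0,1}`, the blocks = the `K`-eigenspaces, `w_±` the Weil
vectors, `Θ` the polarisation, `c₁e^{λΘ} + c₂e^{μΘ}` the h-part of a `K`-secant-type Mukai vector) is NOT asserted in Lean; the
real-carrier form with that identification as a NAMED HYPOTHESIS is `ContractionRankWeilPurity.lean`.
References: [BourbakiAlgebre1a3] Ch. III §7 no. 1, §11 no. 9 (exterior algebra, interior products); [BuchweitzFlenner2008HH]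
Prop. 6.4.4 (why these operators model `σ ∘ ev = ⌟ch`).
-/

open Module Set Set.powersetCard

namespace Summit.Ventures.HSemireg.WeilCarrier

open Summit.Ventures.HSemireg.WedgeBridge Summit.Ventures.HSemireg.WedgeC15
open Summit.Ventures.HSemireg.Wedge Summit.Ventures.HSemireg.Wedge.Hankel Summit.Ventures.HSemireg.Wedge.Weil
open Summit.Ventures.HSemireg.Wedge.WeilPurity
open ExteriorAlgebra (ι)

variable {K : Type*} [Field K] {n : ℕ} {V : Type*} [AddCommGroup V] [Module K V]
  (bV : Basis (Fin (n + n + (n + n))) K V)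

/-! ### 1. Model side, EXACT: `Ψ` of the bridge block products are signed pair products -/

/-- a `Y`-letter passes the ordered product `x_s ⋯ x_{s+m-1}` with the sign `(-1)^m`.
[cite: BourbakiAlgebre1a3, Ch. III §7 no. 1] -/
lemma Y_mul_Xp (c s : ℕ) : ∀ m : ℕ,
    Y K (n + n) c * Xp K n s m = ((-1 : K) ^ m) • (Xp K n s m * Y K (n + n) c)
  | 0 => by rw [Xp, mul_one, one_mul, pow_zero, one_smul]
  | m + 1 => by
    rw [Xp, ← mul_assoc, Y_mul_Xp c s m, smul_mul_assoc, mul_assoc, ← neg_neg (Y K (n + n) c * X K (n + n) (s + m)),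
      ← X_mul_Y_anticomm, mul_neg, mul_assoc, smul_neg, pow_succ, mul_neg_one, neg_smul]

/-- un-interleaving in the transposed order: `(Π y_c)(Π x_c) = (−1)^{C(m+1,2)} Π (x_c ∧ y_c)`.
[cite: BourbakiAlgebre1a3, Ch. III §7 no. 1] -/
lemma Yp_mul_Xp (s : ℕ) : ∀ m : ℕ, Yp K n s m * Xp K n s m = ((-1 : K) ^ ((m + 1).choose 2)) • pp K n s m
  | 0 => by rw [Yp, Xp, pp, mul_one, Nat.choose_eq_zero_of_lt (by norm_num : 0 + 1 < 2), pow_zero, one_smul]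
  | m + 1 => by
    rw [Yp, Xp, pp]
    have h1 : Yp K n s m * Y K (n + n) (s + m) * (Xp K n s m * X K (n + n) (s + m)) =
        ((-1 : K) ^ m) • ((Yp K n s m * Xp K n s m) * (Y K (n + n) (s + m) * X K (n + n) (s + m))) := by
      rw [mul_assoc, ← mul_assoc (Y K (n + n) (s + m)), Y_mul_Xp, smul_mul_assoc, mul_smul_comm,
        mul_assoc (Xp K n s m), ← mul_assoc (Yp K n s m)]
    have hC : (m + 1 + 1).choose 2 = (m + 1) + (m + 1).choose 2 := by
      simpa using Nat.choose_succ_succ' (m + 1) 1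
    rw [h1, Yp_mul_Xp s m, smul_mul_assoc, smul_smul, ← neg_neg (Y K (n + n) (s + m) * X K (n + n) (s + m)),
      ← X_mul_Y_anticomm, mul_neg, smul_neg, ← neg_smul, hC]
    congr 1
    ring

/-- `Ψ(x_s ⋯ x_{s+m-1}) = Y_s ⋯ Y_{s+m-1}` (the bridge's upper-block wedge letters go to HankelRank's `Y`-letters, EXACTLY). -/
lemma Ψ_xprodFrom_eq (s : ℕ) : ∀ m : ℕ, Ψ bV (xprodFrom bV s (s + m)) = Yp K n s m
  | 0 => by rw [Nat.add_zero, xprodFrom_of_le bV (le_refl s), map_one, Yp]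
  | m + 1 => by
    rw [Nat.add_succ, xprodFrom, if_pos (Nat.le_add_right s m), map_mul, Ψ_xprodFrom_eq s m, Ψ_XN, Yp]

/-- `Ψ(y_s ⋯ y_{s+m-1}) = X_s ⋯ X_{s+m-1}` (EXACTLY). -/
lemma Ψ_yprodFrom_eq (s : ℕ) : ∀ m : ℕ, Ψ bV (yprodFrom bV s (s + m)) = Xp K n s m
  | 0 => by rw [Nat.add_zero, yprodFrom_of_le bV (le_refl s), map_one, Xp]
  | m + 1 => by
    rw [Nat.add_succ, yprodFrom, if_pos (Nat.le_add_right s m), map_mul, Ψ_yprodFrom_eq s m, Ψ_YN, Xp]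

/-- **model side, upper block, EXACT:** `Ψ(x_n ⋯ x_{2n-1} · y_n ⋯ y_{2n-1}) = (−1)^{C(n+1,2)} · Π_{c ≥ n}(x_c ∧ y_c)`
(th-7's upper pair product `pp n n`). [cite: BourbakiAlgebre1a3, Ch. III §7 no. 1] -/
theorem Ψ_up_pp : Ψ bV (xprodFrom bV n (n + n) * yprodFrom bV n (n + n)) =
    ((-1 : K) ^ ((n + 1).choose 2)) • pp K n n n := by
  rw [map_mul, Ψ_xprodFrom_eq, Ψ_yprodFrom_eq, Yp_mul_Xp]

/-- **model side, lower block, EXACT:** `Ψ(x_0 ⋯ x_{n-1} · y_0 ⋯ y_{n-1}) = (−1)^{C(n+1,2)} · Π_{c < n}(x_c ∧ y_c)`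
(th-7's lower pair product `pp 0 n`). [cite: BourbakiAlgebre1a3, Ch. III §7 no. 1] -/
theorem Ψ_low_pp : Ψ bV (xprod bV n * yprod bV n) = ((-1 : K) ^ ((n + 1).choose 2)) • pp K n 0 n := by
  have hx : xprod bV n = xprodFrom bV 0 (0 + n) := by rw [Nat.zero_add]; exact xprod_eq_xprodFrom bV n
  have hy : yprod bV n = yprodFrom bV 0 (0 + n) := by rw [Nat.zero_add]; exact yprod_eq_yprodFrom bV n
  rw [map_mul, hx, hy, Ψ_xprodFrom_eq, Ψ_yprodFrom_eq, Yp_mul_Xp]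

/-! ### 2. Transport with exact constants -/

/-- the un-interleaving sign `s = (−1)^{C(n+1,2)}` squares to one. -/
lemma unInterleaveSign_mul_self : (-1 : K) ^ ((n + 1).choose 2) * (-1 : K) ^ ((n + 1).choose 2) = 1 := by
  rw [← pow_add, ← two_mul, pow_mul, neg_one_sq, one_pow]

/-- `(−1)^{n·n} = (−1)ⁿ`. -/
lemma neg_one_pow_mul_self_eq : (-1 : K) ^ (n * n) = (-1) ^ n := by
  rcases Nat.even_or_odd n with he | ho
  · rw [he.neg_one_pow, (he.mul_left n).neg_one_pow]
  · rw [ho.neg_one_pow, (ho.mul ho).neg_one_pow]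

/-- **TRANSPORT LEMMA (exact form).** For every degree `k`, `dim S_k(Ecl q (2n) + a·w₊ + b·w₋)` with the two-exponential
`q_j = c₁λ^j + c₂μ^j` equals the wedge-model rank of th-7's pair-normalised class `vP c₁ c₂ λ μ (a·s) (b·(−1)^{n·n}·s)`,
`s = (−1)^{C(n+1,2)}` — p4's `finrank_S_eq_model` with the units COMPUTED. [cite: BourbakiAlgebre1a3, Ch. III §11 no. 9] -/
theorem finrank_S_weil_eq_vP (c₁ c₂ lam mu a b : K) (k : ℕ) :
    Module.finrank K (S K (Lsp bV) k
        (Ecl bV (fun j => c₁ * lam ^ j + c₂ * mu ^ j) (n + n) + a • wUp bV n + b • wLow bV n)) =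
      Module.finrank K (LinearMap.range (Wedge.Hankel.wedge K (n + n) k
        (vP K n c₁ c₂ lam mu (a * (-1 : K) ^ ((n + 1).choose 2))
          (b * (-1 : K) ^ (n * n) * (-1 : K) ^ ((n + 1).choose 2))))) := by
  have hp : n ≤ n + n := Nat.le_add_right n n
  set ε : K := (-1 : K) ^ ((n + n - n) * n) with hε
  have hεn : ε = (-1 : K) ^ (n * n) := by rw [hε, Nat.add_sub_cancel]
  have hεε : ε * ε = 1 := by rw [hε, ← mul_pow, neg_one_mul, neg_neg, one_pow]
  let v' : ExteriorAlgebra K (W K (Lsp bV)) :=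
    gw bV (fun j => c₁ * lam ^ j + c₂ * mu ^ j) (n + n) + a • (xprodFrom bV n (n + n) * yprodFrom bV n (n + n)) +
      (b * ε) • (xprod bV n * yprod bV n)
  have hΦ : WedgeBridge.Φ K (Lsp bV) (vacuum bV) v' =
      Ecl bV (fun j => c₁ * lam ^ j + c₂ * mu ^ j) (n + n) + a • wUp bV n + b • wLow bV n := by
    simp only [v', map_add, map_smul, Φ_gw, Φ_up bV hp, Φ_low bV hp, smul_smul, ← hε, mul_assoc, hεε, mul_one]
  have hΨ : Ψ bV v' = vP K n c₁ c₂ lam mu (a * (-1 : K) ^ ((n + 1).choose 2))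
      (b * (-1 : K) ^ (n * n) * (-1 : K) ^ ((n + 1).choose 2)) := by
    simp only [v', map_add, map_smul, Ψ_gw, Ψ_up_pp, Ψ_low_pp, smul_smul, vP, hεn]
  rw [← hΦ, finrank_S_eq_of_injective (Φ_vacuum_injective bV) k v', finrank_range_wedge_eq, hΨ]

/-! ### 3. The purity locus on the carrier -/

open Classical in
/-- **THE WEIL-FRAME PURITY LOCUS ON THE CARRIER (FORMULA-N PART B §L.5; STRUCTURE.md C16), every field, every `n ≥ 1`.**
For the carrier Weil class `Ecl bV q (2n) + a·wUp bV n + b·wLow bV n` with two-exponential h-part `q_j = c₁λ^j + c₂μ^j`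
(`λ ≠ μ`, `c₁c₂ab ≠ 0`): `dim S_n + 4 + 2·[(−1)ⁿ·ab = c₁c₂(λ−μ)^{2n}] = 4·C(2n,n)` — generic value `4·C(2n,n) − 4`, dropping by
exactly two on the locus.  (The sign `(−1)ⁿ` is the exact carrier↔model constant: `(−1)^{n·n}` from p4's `Φ_low`, the two
un-interleaving signs cancelling.) [cite: BourbakiAlgebre1a3, Ch. III §11 no. 9] [cite: BuchweitzFlenner2008HH, Prop. 6.4.4] -/
theorem finrank_S_weil_purity (hn : 0 < n) {c₁ c₂ lam mu a b : K} (h1 : c₁ ≠ 0) (h2 : c₂ ≠ 0) (hlm : lam ≠ mu)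
    (ha : a ≠ 0) (hb : b ≠ 0) :
    Module.finrank K (S K (Lsp bV) n
        (Ecl bV (fun j => c₁ * lam ^ j + c₂ * mu ^ j) (n + n) + a • wUp bV n + b • wLow bV n)) + 4 +
      2 * (if (-1 : K) ^ n * (a * b) = c₁ * c₂ * (lam - mu) ^ (2 * n) then 1 else 0) = 4 * (n + n).choose n := by
  have hs : (-1 : K) ^ ((n + 1).choose 2) ≠ 0 := pow_ne_zero _ (neg_ne_zero.mpr one_ne_zero)
  have hnn : (-1 : K) ^ (n * n) ≠ 0 := pow_ne_zero _ (neg_ne_zero.mpr one_ne_zero)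
  rw [finrank_S_weil_eq_vP]
  have h := weilPurity K (n := n) hn (c₁ := c₁) (c₂ := c₂) (lam := lam) (mu := mu)
    (a := a * (-1 : K) ^ ((n + 1).choose 2)) (b := b * (-1 : K) ^ (n * n) * (-1 : K) ^ ((n + 1).choose 2))
    h1 h2 hlm (mul_ne_zero ha hs) (mul_ne_zero (mul_ne_zero hb hnn) hs)
  have e : a * (-1 : K) ^ ((n + 1).choose 2) * (b * (-1 : K) ^ (n * n) * (-1 : K) ^ ((n + 1).choose 2)) =
      (-1 : K) ^ n * (a * b) := by
    rw [show a * (-1 : K) ^ ((n + 1).choose 2) * (b * (-1 : K) ^ (n * n) * (-1 : K) ^ ((n + 1).choose 2)) =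
        ((-1 : K) ^ ((n + 1).choose 2) * (-1 : K) ^ ((n + 1).choose 2)) * (-1 : K) ^ (n * n) * (a * b) by ring,
      unInterleaveSign_mul_self, one_mul, neg_one_pow_mul_self_eq]
  rw [e] at h
  exact h

open Classical in
/-- **`n = 2`, stated for the TREE's `ContractionSpan.span ↑L ↑(Ann L) x` literally** (the bridge's `S_2` IS that span,
`WedgeBridge.S_two_eq`): for the carrier Weil class `Ecl bV q 4 + a·wUp bV 2 + b·wLow bV 2`, `q_j = c₁λ^j + c₂μ^j`, `λ ≠ μ`,
`c₁c₂ab ≠ 0`: `dim = 18` on the purity locus `ab = c₁c₂(λ−μ)⁴`, `dim = 20` off it — the g = 4 anchor number `18` of the cell's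
T4a / STEP-0 in the WEIL frame for a TWO-EXPONENTIAL h-part (p4's `ContractionRankWeilPure` does the decomposable two-ENDED one).
[cite: BourbakiAlgebre1a3, Ch. III §11 no. 9] [cite: BuchweitzFlenner2008HH, Prop. 6.4.4] -/
theorem finrank_contractionSpan_weil_purity_two (bV : Basis (Fin (2 + 2 + (2 + 2))) K V) {c₁ c₂ lam mu a b : K}
    (h1 : c₁ ≠ 0) (h2 : c₂ ≠ 0) (hlm : lam ≠ mu) (ha : a ≠ 0) (hb : b ≠ 0) :
    Module.finrank K (Summit.Ventures.HSemireg.ContractionSpan.span (Lsp bV : Set V)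
        ((Lsp bV).dualAnnihilator : Set (Module.Dual K V))
        (Ecl bV (fun j => c₁ * lam ^ j + c₂ * mu ^ j) (2 + 2) + a • wUp bV 2 + b • wLow bV 2)) =
      if a * b = c₁ * c₂ * (lam - mu) ^ 4 then 18 else 20 := by
  rw [← S_two_eq]
  have h := finrank_S_weil_purity bV (n := 2) (by norm_num) h1 h2 hlm ha hb
  have e : (2 + 2).choose 2 = 6 := by decide
  rw [e, show 2 * 2 = 4 from rfl, show ((-1 : K) ^ 2 * (a * b)) = a * b by rw [neg_one_sq, one_mul]] at h
  split_ifs at h ⊢ with hdet <;> omega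

open Classical in
/-- the same for the bridge's `S_2` (`n = 2`). -/
theorem finrank_S_weil_purity_two (bV : Basis (Fin (2 + 2 + (2 + 2))) K V) {c₁ c₂ lam mu a b : K}
    (h1 : c₁ ≠ 0) (h2 : c₂ ≠ 0) (hlm : lam ≠ mu) (ha : a ≠ 0) (hb : b ≠ 0) :
    Module.finrank K (S K (Lsp bV) 2
        (Ecl bV (fun j => c₁ * lam ^ j + c₂ * mu ^ j) (2 + 2) + a • wUp bV 2 + b • wLow bV 2)) =
      if a * b = c₁ * c₂ * (lam - mu) ^ 4 then 18 else 20 := by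
  rw [S_two_eq, finrank_contractionSpan_weil_purity_two bV h1 h2 hlm ha hb]

end Summit.Ventures.HSemireg.WeilCarrier
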